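import Summits.ResolutionOfSingularities.ResolutionOfSingularities.Theorems.MarkedTransferCampaignW46FiniteExitBoundNodes
import Summits.ResolutionOfSingularities.ResolutionOfSingularities.Theorems.MarkedTransferCampaignW46ExitTreeGerm
import Summits.ResolutionOfSingularities.ResolutionOfSingularities.Theorems.MarkedTransferCampaignW46ExitTreeKonig
import Literature.RingTheory.RegularLocalRing.QuotientDVR
import HarnessLib

/-!
# [OURS · L1 W4.6 rung (i-a)′] ASSEMBLY: rung (i-a)′ `PlaneIsolatedFinLocalExitBound` (hence rung (i-a) in all its forms)
# from ONE remaining hypothesis — «NO INFINITE MARKED BRANCH» (Theorem A of the marked quadratic tree)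
# (cell res-hironaka, LADDER-RESOLUTION rung L, D-0089; campaign s46, seat res-D-pv-046 AS res-L1-s46-pv-9; host route
# MarkedTransfer, `--supports stmt-ResolutionOfSingularities-16156 --as helper`)

HONEST FRAMING. Nothing here is a statement of H. Hironaka's manuscript (2017-03-23, [Hironaka2017]) and nothing here
asserts that any statement of it holds. This file COMPOSES kernel-checked OURS pieces of the W4.6 campaign: the run layer
and glue (this seat, p497699/p498215), the scheme→RLR dictionary (this seat, parts 1–4), res-L1-s46-pv-8's marked quadratic
tree (`…W46ExitTree*.lean`: the exit count `ν`, Zariski's count `sum_exitCount_lt`, König, the germ invariant `germExitCount`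
and the curve case `curveOrder_colon_lt`). The ONE hypothesis left is displayed as `hA` below; it is NOT proved here.
AI review is weaker than expert review. No `sorry`; axioms standard.

## The measure

`μ(A, E, ξ) := germExitCount 𝒪_{Z,ξ} J_ξ b` (pv-8's ring-isomorphism-invariant germ invariant: the exact order for a curve germ,
the number of nodes of the marked quadratic tree for a surface germ).

## The remaining hypothesis `hA` («Theorem A», to be proved by res-L1-s46-pv-8 / res-L1-s46-pv-1)

For every ambient datum `A`, closed point `ξ` with `dim 𝒪_{Z,ξ} = 2`, exponent `b` and ideal `I` of
`R := (𝒪_{Z,ξ} → K(Z)).range` such that the node `⟨R, I⟩` is TAME (`I ⊆ 𝔪^b`, `I ⊄ 𝔪^{2b}`) and ISOLATED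
(`I ⊄ (q^b)` for every prime element `q` of `R`): there is no infinite chain of marked steps
`⟨R, I⟩ = n₀ → n₁ → n₂ → ⋯` (`MarkedStep b`: two-dimensional first quadratic transforms marked with the controlled
transforms, every `nᵢ` tame). The pure-algebra form (every field `L`, every tame isolated node) implies it
(`planeIsolatedFinLocalExitBound_of_noInfiniteMarkedBranch`).

## Proof of the centre inequality (glue p498215's `hcentre`) from `hA`, by `d := dim 𝒪_{Z,ξ} ∈ {0, 1, 2}`

* `d = 0` is impossible (`J ≠ 0` on an integral scheme has non-zero stalks, but `J_ξ ⊆ 𝔪_ξ^b = 0`).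
* `d = 1`: `𝒪_{Z,ξ}` is a DVR, every point over `ξ` has the SAME local ring `𝒪_{Z,ξ}` in `K(Z)` (a local ring dominating a
  valuation ring equals it), so there is at most one point over `ξ` (dictionary injectivity) and its germ is
  `(J_ξ : 𝔪^b)`, of strictly smaller exact order (`curveOrder_colon_lt`).
* `d = 2`: the points of `Sing(E′)` over `ξ` give DISTINCT two-dimensional quadratic transforms `S_{ξ′}` of `R` marked with
  `ctrlTransform b R I S_{ξ′}` (dictionary parts 2–4), the root is tame (part 4) and `μ` is the exit count at these nodes
  (`germExitCount_eq_exitCount`); Zariski's count `sum_exitCount_lt_of_no_infinite_branch` (pv-8) under `hA` gives the drop.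

## References

* this campaign: p497699, p498215, p501974, p503229, parts 3–4 (this seat); p500395, p501084, p502709, p502849 + ExitTreeGerm
  (res-D-pv-044 AS res-L1-s46-pv-8).
* O. Zariski, P. Samuel, *Commutative Algebra* II (1960), Appendix 5. [ZariskiSamuel1960]
-/

noncomputable section

set_option linter.dupNamespace false -- mandated namespace of this single-conjunct summit

open CategoryTheory AlgebraicGeometry TopologicalSpace IsLocalRing

namespace Summit.ResolutionOfSingularities.ResolutionOfSingularities.Theorems

namespace CampaignW46

open Literature.AlgebraicGeometry.Resolution
open Literature.AlgebraicGeometry.Hironaka2017.S02Preliminaries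
open Scheme.IdealSheafData

universe u

variable {p : ℕ} [Fact p.Prime] {K : Type u} [Field K] [CharP K p]

/-! ## Small facts about stalks of ambient data -/

/-- The dimension of a stalk of an ambient datum at a closed point of a state of `regimePlaneIsolated` is `0`, `1` or `2`.
[folklore] -/
theorem exists_nat_ringKrullDim_stalk_le_two (A : AmbientDatum p K) {E : IdealExponent A.Z}
    (hRg : regimePlaneIsolated A E) {ξ : A.Z} (hξ : IsClosed ({ξ} : Set A.Z)) :
    ∃ n : ℕ, ringKrullDim (A.Z.presheaf.stalk ξ) = n ∧ n ≤ 2 := by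
  have hle : ringKrullDim (A.Z.presheaf.stalk ξ) ≤ ((2 : ℕ) : WithBot ℕ∞) := by
    rw [ringKrullDim_stalk_eq_of_isClosed_ambient A hξ]
    exact hRg.1
  have h0 : (0 : WithBot ℕ∞) ≤ ringKrullDim (A.Z.presheaf.stalk ξ) := ringKrullDim_nonneg_of_nontrivial
  generalize hd : ringKrullDim (A.Z.presheaf.stalk ξ) = d at hle h0
  induction d using WithBot.recBotCoe with
  | bot => exact absurd h0 (by simp)
  | coe m =>
    induction m using ENat.recTopCoe with
    | top =>
      exfalso
      have h2 : ((⊤ : ℕ∞) : WithBot ℕ∞) ≤ ((2 : ℕ) : ℕ∞) := hle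
      exact (not_le_of_gt (ENat.coe_lt_top 2)) (WithBot.coe_le_coe.mp h2)
    | coe n =>
      refine ⟨n, rfl, ?_⟩
      have : ((n : ℕ∞) : WithBot ℕ∞) ≤ ((2 : ℕ) : ℕ∞) := hle
      exact_mod_cast this

/-- At a point of `Sing(E)` of a standard ideal exponent the local ring is not a field (its stalk of `J ≠ 0` is a non-zero
ideal inside `𝔪^b`, `b ≥ 1`). [folklore] -/
theorem maximalIdeal_stalk_ne_bot_of_mem_sing (A : AmbientDatum p K) {E : IdealExponent A.Z} (hE : E.IsStandard)
    {ξ : A.Z} (hξS : ξ ∈ E.sing) : maximalIdeal (A.Z.presheaf.stalk ξ) ≠ ⊥ := by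
  haveI := ambient_isIntegral A
  intro hbot
  have hJ := (mem_sing_iff_stalkIdeal_le_pow E ξ).mp hξS
  apply stalkIdeal_ne_bot_of_ne_bot hE.1 ξ
  rw [← le_bot_iff]
  refine hJ.trans (le_of_eq ?_)
  rw [hbot]
  exact zero_pow (Nat.pos_iff_ne_zero.mp hE.2)

/-! ## The curve case: a blown-up closed point of a regular curve -/

section Curve

variable {Z Z' : Scheme.{u}} [IsIntegral Z] [IsIntegral Z'] [IsLocallyNoetherian Z] {π : Z' ⟶ Z} {J : Z.IdealSheafData}

omit [IsIntegral Z'] in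
/-- **Over a point whose local ring is a valuation ring, a blowing up of the closed point changes nothing**: the stalk map
`𝒪_{Z,πξ′} → 𝒪_{Z′,ξ′}` is bijective (a local ring of `K(Z)` dominating a valuation ring of `K(Z)` equals it).
[cite: Cutkosky2014, §2.1] -/
theorem stalkMap_bijective_of_valuationRing (hπ : IsBlowup π J) (ξ' : Z') [ValuationRing (Z.presheaf.stalk (π ξ'))] :
    Function.Bijective (π.stalkMap ξ').hom := by
  refine ⟨hπ.stalkMap_injective ξ', fun a' => ?_⟩
  have hdom := subringDominates_range_stalkEmb hπ (ξ' := ξ') rfl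
  -- `ε a'` lies in the valuation ring `𝒪_{Z,πξ′} ⊆ K(Z)`
  set z := hπ.stalkEmb ξ' a' with hz
  rcases ValuationRing.isInteger_or_isInteger (Z.presheaf.stalk (π ξ')) z with ⟨a, ha⟩ | ⟨c, hc⟩
  · refine ⟨a, hπ.stalkEmb_injective ξ' ?_⟩
    rw [hπ.stalkEmb_stalkMap, ha]
  · by_cases hz0 : z = 0
    · refine ⟨0, hπ.stalkEmb_injective ξ' ?_⟩
      rw [map_zero, map_zero, ← hz, hz0]
    · -- `z⁻¹ = c ∈ 𝒪_{Z,πξ′}` and `(z⁻¹)⁻¹ = z ∈ ε(𝒪_{Z′,ξ′})`: domination forces `z ∈ 𝒪_{Z,πξ′}`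
      have hzinv : z⁻¹ ∈ (algebraMap (Z.presheaf.stalk (π ξ')) Z.functionField).range := ⟨c, hc⟩
      have hmem : z⁻¹⁻¹ ∈ (hπ.stalkEmb ξ').range := by rw [inv_inv]; exact ⟨a', rfl⟩
      obtain ⟨a, ha⟩ := hdom.2 _ hzinv hmem
      refine ⟨a, hπ.stalkEmb_injective ξ' ?_⟩
      rw [hπ.stalkEmb_stalkMap, ha, inv_inv]

end Curve

/-! ## The centre inequality for `μ := germExitCount`, from «no infinite marked branch» -/

/-- **The centre inequality of the glue for the germ exit count**, from the hypothesis «no infinite marked branch above a tame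
isolated root which is the germ of an ambient datum at a closed point of dimension two» (Theorem A, scheme-anchored form).
Cases `dim 𝒪_{Z,ξ} = 0` (impossible), `= 1` (DVR: `curveOrder_colon_lt`), `= 2` (marked quadratic tree:
`sum_exitCount_lt_of_no_infinite_branch`). [cite: ZariskiSamuel1960, Appendix 5] -/
theorem germExitCount_centre_lt
    (hA : ∀ (A : AmbientDatum p K) (ξ : A.Z), IsClosed ({ξ} : Set A.Z) → ringKrullDim (A.Z.presheaf.stalk ξ) = 2 →
      ∀ (b : ℕ) (I : Ideal (haveI := ambient_isIntegral A;
        (algebraMap (A.Z.presheaf.stalk ξ) A.Z.functionField).range)),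
        (haveI := ambient_isIntegral A
         IsTameNode b (⟨(algebraMap (A.Z.presheaf.stalk ξ) A.Z.functionField).range, I⟩ : MarkedNode A.Z.functionField)) →
        (haveI := ambient_isIntegral A
         ∀ q : (algebraMap (A.Z.presheaf.stalk ξ) A.Z.functionField).range, Prime q → ¬ I ≤ Ideal.span {q ^ b}) →
        (haveI := ambient_isIntegral A
         ∀ c : ℕ → MarkedNode A.Z.functionField,
          c 0 = ⟨(algebraMap (A.Z.presheaf.stalk ξ) A.Z.functionField).range, I⟩ →
          (∀ i, MarkedStep b (c i) (c (i + 1))) → False))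
    (A A' : AmbientDatum p K) (E : IdealExponent A.Z) (E' : IdealExponent A'.Z) (ξ : A.Z)
    (hξ : IsClosed ({ξ} : Set A.Z)) (π : A'.Z ⟶ A.Z)
    (hRg : regimePlaneIsolated A E) (hRg' : regimePlaneIsolated A' E') (hE : E.IsStandard) (_hE' : E'.IsStandard)
    (hξS : ξ ∈ E.sing) (hD : E.IsPermissibleCentre A.hom ⟨{ξ}, hξ⟩) (_hhom : A'.hom = π ≫ A.hom)
    (hπ : IsBlowup π (vanishingIdeal ⟨{ξ}, hξ⟩)) (hEE' : E' = E.transform π ⟨{ξ}, hξ⟩)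
    (t : Finset A'.Z) (ht : ∀ ξ' ∈ t, ξ' ∈ E'.sing ∧ π ξ' = ξ) :
    t.sum (fun ξ' => germExitCount (A'.Z.presheaf.stalk ξ') (stalkIdeal E'.J ξ') E'.b) <
      germExitCount (A.Z.presheaf.stalk ξ) (stalkIdeal E.J ξ) E.b := by
  classical
  haveI := ambient_isIntegral A
  haveI := ambient_isIntegral A'
  haveI : IsLocallyNoetherian A.Z := ambient_isLocallyNoetherian A
  haveI : IsLocallyNoetherian A'.Z := ambient_isLocallyNoetherian A'
  haveI hregO : IsRegularLocalRing (A.Z.presheaf.stalk ξ) := ambient_isRegular A ξ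
  have hb : 0 < E.b := hE.2
  have hbE' : E'.b = E.b := by rw [hEE']; rfl
  have hne : maximalIdeal (A.Z.presheaf.stalk ξ) ≠ ⊥ := maximalIdeal_stalk_ne_bot_of_mem_sing A hE hξS
  have hJξ0 : stalkIdeal E.J ξ ≠ ⊥ := stalkIdeal_ne_bot_of_ne_bot hE.1 ξ
  have hJξ : stalkIdeal E.J ξ ≤ maximalIdeal (A.Z.presheaf.stalk ξ) ^ E.b := (mem_sing_iff_stalkIdeal_le_pow E ξ).mp hξS
  have hm : stalkIdeal (vanishingIdeal ⟨{ξ}, hξ⟩) ξ = maximalIdeal (A.Z.presheaf.stalk ξ) :=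
    stalkIdeal_vanishingIdeal_singleton (X := A.Z) hξ
  -- every `ξ' ∈ t` is closed and over `ξ`, and its stalk has the dimension of `𝒪_{Z,ξ}`
  have hcl' : ∀ ξ' ∈ t, IsClosed ({ξ'} : Set A'.Z) := fun ξ' hξ' => hRg'.2.2 (ht ξ' hξ').1
  have hdim' : ∀ ξ' ∈ t, ringKrullDim (A'.Z.presheaf.stalk ξ') = ringKrullDim (A.Z.presheaf.stalk ξ) :=
    fun ξ' hξ' => ringKrullDim_stalk_eq_of_blowup_closedPoint A A' hξ hne hπ (hcl' ξ' hξ')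
  -- the stalk at `ξ' ∈ t` of `E′.J` is a controlled transform: its germ data, transported
  have hJ'eq : E'.J = (E.transform π ⟨{ξ}, hξ⟩).J := by rw [hEE']
  -- the dimension trichotomy
  obtain ⟨n, hn, hn2⟩ := exists_nat_ringKrullDim_stalk_le_two A hRg hξ
  interval_cases n
  · -- `d = 0`: impossible
    exfalso
    have hf : IsField (A.Z.presheaf.stalk ξ) := by
      haveI : Ring.KrullDimLE 0 (A.Z.presheaf.stalk ξ) := Ring.krullDimLE_iff.mpr hn.le
      exact Ring.KrullDimLE.isField_of_isDomain
    exact hne ((IsLocalRing.isField_iff_maximalIdeal_eq).mp hf)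
  · -- `d = 1`: the DVR case
    have hn1 : ringKrullDim (A.Z.presheaf.stalk ξ) = 1 := by rw [hn]; rfl
    haveI hdvr : IsDiscreteValuationRing (A.Z.presheaf.stalk ξ) :=
      Literature.RingTheory.RegularLocalRing.isDiscreteValuationRing_of_ringKrullDim_eq_one hn1
    -- the value at `ξ`
    rw [germExitCount_eq_curveOrder hn1]
    -- every point over `ξ` has bijective stalk map; hence all of `t` is one point
    have hbij : ∀ ξ' ∈ t, Function.Bijective (π.stalkMap ξ').hom := by
      intro ξ' hξ'
      obtain ⟨-, hπξ'⟩ := ht ξ' hξ'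
      haveI : ValuationRing (A.Z.presheaf.stalk (π ξ')) := by rw [hπξ']; infer_instance
      exact stalkMap_bijective_of_valuationRing hπ ξ'
    have hrange : ∀ ξ' ∈ t, (hπ.stalkEmb ξ').range = (algebraMap (A.Z.presheaf.stalk ξ) A.Z.functionField).range := by
      intro ξ' hξ'
      obtain ⟨-, hπξ'⟩ := ht ξ' hξ'
      subst hπξ'
      ext z
      constructor
      · rintro ⟨a', rfl⟩
        obtain ⟨a, rfl⟩ := (hbij ξ' hξ').2 a'
        exact ⟨a, (hπ.stalkEmb_stalkMap ξ' a).symm⟩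
      · rintro ⟨a, rfl⟩
        exact ⟨(π.stalkMap ξ').hom a, hπ.stalkEmb_stalkMap ξ' a⟩
    have hsub : ∀ ξ₁ ∈ t, ∀ ξ₂ ∈ t, ξ₁ = ξ₂ := by
      intro ξ₁ h₁ ξ₂ h₂
      exact eq_of_range_stalkEmb_eq hπ (((ht ξ₁ h₁).2).trans ((ht ξ₂ h₂).2).symm)
        ((hrange ξ₁ h₁).trans (hrange ξ₂ h₂).symm)
    -- the value at a point over `ξ`
    have hval : ∀ ξ' ∈ t, germExitCount (A'.Z.presheaf.stalk ξ') (stalkIdeal E'.J ξ') E'.b <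
        curveOrder (A.Z.presheaf.stalk ξ) (stalkIdeal E.J ξ) := by
      intro ξ' hξ'
      obtain ⟨-, hπξ'⟩ := ht ξ' hξ'
      have hb2 := hbij ξ' hξ'
      subst hπξ'
      let e : A.Z.presheaf.stalk (π ξ') ≃+* A'.Z.presheaf.stalk ξ' := RingEquiv.ofBijective (π.stalkMap ξ').hom hb2
      have he : e.toRingHom = (π.stalkMap ξ').hom := rfl
      haveI : IsRegularLocalRing (A'.Z.presheaf.stalk ξ') := ambient_isRegular A' ξ'
      have hdim1 : ringKrullDim (A'.Z.presheaf.stalk ξ') = 1 := (hdim' ξ' hξ').trans hn1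
      -- the stalk of the transform is `e (J : 𝔪^b)`
      have hid : stalkIdeal E'.J ξ' =
          (Submodule.colon (stalkIdeal E.J (π ξ'))
            ((maximalIdeal (A.Z.presheaf.stalk (π ξ')) ^ E.b : Ideal (A.Z.presheaf.stalk (π ξ'))) :
              Set (A.Z.presheaf.stalk (π ξ')))).map e.toRingHom := by
        rw [hJ'eq, show (E.transform π ⟨{π ξ'}, hξ⟩).J = controlledTransform π (vanishingIdeal ⟨{π ξ'}, hξ⟩) E.J E.b
          from rfl, hπ.stalkIdeal_controlledTransform E.J E.b ξ', map_colon_eq_of_ringEquiv, Ideal.map_pow,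
          stalkIdeal_comap_eq_map_stalkMap, stalkIdeal_comap_eq_map_stalkMap, hm, he]
      have hid' : stalkIdeal E'.J ξ' =
          (Submodule.colon (stalkIdeal E.J (π ξ'))
            ((maximalIdeal (A.Z.presheaf.stalk (π ξ')) ^ E.b : Ideal (A.Z.presheaf.stalk (π ξ'))) :
              Set (A.Z.presheaf.stalk (π ξ')))).map e := hid
      rw [hid', hbE', germExitCount_map_ringEquiv, germExitCount_eq_curveOrder hn1]
      exact curveOrder_colon_lt hJξ0 hb hJξ
    -- sum over at most one point
    rcases t.eq_empty_or_nonempty with rfl | ⟨ξ₀, hξ₀⟩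
    · rw [Finset.sum_empty]
      -- `0 < ord`: the exact order exceeds that of the controlled transform
      exact lt_of_le_of_lt (Nat.zero_le _) (curveOrder_colon_lt hJξ0 hb hJξ)
    · have ht₀ : t = {ξ₀} := Finset.eq_singleton_iff_unique_mem.2 ⟨hξ₀, fun ξ' hξ' => hsub ξ' hξ' ξ₀ hξ₀⟩
      rw [ht₀, Finset.sum_singleton]
      exact hval ξ₀ hξ₀
  · -- `d = 2`: the marked quadratic tree
    have hn2' : ringKrullDim (A.Z.presheaf.stalk ξ) = 2 := by rw [hn]; rfl
    set ι := algebraMap (A.Z.presheaf.stalk ξ) A.Z.functionField with hι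
    set R : Subring A.Z.functionField := ι.range with hR
    set I : Ideal R := (stalkIdeal E.J ξ).map ι.rangeRestrict with hI
    haveI hregR : IsRegularLocalRing R := isRegularLocalRing_range_of ξ
    have htame : IsTameNode E.b (⟨R, I⟩ : MarkedNode A.Z.functionField) :=
      isTameNode_range_of_regime hRg' hξS hD hπ hEE' hn2'
    -- isolation of the root, in prime-element form
    have hinj : Function.Injective ι := algebraMap_stalk_functionField_injective ξ
    have hbijι : Function.Bijective ι.rangeRestrict :=
      ⟨fun _ _ h => hinj (congrArg Subtype.val h), ι.rangeRestrict_surjective⟩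
    let eR : A.Z.presheaf.stalk ξ ≃+* R := RingEquiv.ofBijective ι.rangeRestrict hbijι
    have heR : eR.toRingHom = ι.rangeRestrict := rfl
    have hiso : ∀ q : R, Prime q → ¬ I ≤ Ideal.span {q ^ E.b} := by
      intro q hq hle
      obtain ⟨a, rfl⟩ := eR.surjective q
      have ha : Prime a := (MulEquiv.prime_iff eR.toMulEquiv).mp hq
      have hle' : stalkIdeal E.J ξ ≤ (Ideal.span {a}) ^ E.b := by
        have h := Ideal.comap_mono (f := ι.rangeRestrict) hle
        rw [hI, Ideal.comap_map_of_bijective _ hbijι] at h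
        refine h.trans ?_
        rw [Ideal.span_singleton_pow, ← map_pow, show ((eR (a ^ E.b) : R)) = ι.rangeRestrict (a ^ E.b) from rfl,
          ← Set.image_singleton, ← Ideal.map_span, Ideal.comap_map_of_bijective _ hbijι]
      haveI : (Ideal.span {a}).IsPrime := (Ideal.span_singleton_prime ha.ne_zero).mpr ha
      refine stalkIdeal_not_le_prime_pow_of_regime hRg ξ (Ideal.span {a}) (fun hmax => ?_) hle'
      -- `𝔪` is not principal in dimension two
      haveI : (Ideal.span {a} : Ideal (A.Z.presheaf.stalk ξ)).IsPrincipal := ⟨⟨a, rfl⟩⟩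
      have hmin : maximalIdeal (A.Z.presheaf.stalk ξ) ∈ (Ideal.span {a} : Ideal (A.Z.presheaf.stalk ξ)).minimalPrimes := by
        rw [← hmax, Ideal.minimalPrimes_eq_subsingleton_self]
        exact Set.mem_singleton _
      have h1 := Ideal.height_le_one_of_isPrincipal_of_mem_minimalPrimes (Ideal.span {a}) _ hmin
      have h2 : ringKrullDim (A.Z.presheaf.stalk ξ) ≤ 1 := by
        rw [← IsLocalRing.maximalIdeal_height_eq_ringKrullDim]; exact_mod_cast h1
      rw [hn2'] at h2
      exact absurd h2 (by decide)
    have hno := hA A ξ hξ hn2' E.b I htame hiso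
    -- the nodes over `ξ`
    let σ : A'.Z → Subring A.Z.functionField := fun ξ' => (hπ.stalkEmb ξ').range
    have hσinj : Set.InjOn σ t := fun ξ₁ h₁ ξ₂ h₂ h =>
      eq_of_range_stalkEmb_eq hπ (((ht ξ₁ h₁).2).trans ((ht ξ₂ h₂).2).symm) h
    have hF : ∀ S' ∈ t.image σ, IsQuadraticTransform R S' ∧ ringKrullDim S' = 2 := by
      intro S' hS'
      obtain ⟨ξ', hξ', rfl⟩ := Finset.mem_image.mp hS'
      obtain ⟨-, hπξ'⟩ := ht ξ' hξ'
      exact ⟨isQuadraticTransform_range_stalkEmb' hπ hπξ' hm,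
        (ringKrullDim_range_stalkEmb hπ ξ').trans ((hdim' ξ' hξ').trans hn2')⟩
    -- the values at the nodes
    have hval : ∀ ξ' ∈ t, germExitCount (A'.Z.presheaf.stalk ξ') (stalkIdeal E'.J ξ') E'.b =
        exitCount E.b (σ ξ') (ctrlTransform E.b R I (σ ξ')) := by
      intro ξ' hξ'
      obtain ⟨-, hπξ'⟩ := ht ξ' hξ'
      haveI : IsRegularLocalRing (A'.Z.presheaf.stalk ξ') := ambient_isRegular A' ξ'
      have hdim2 : ringKrullDim (A'.Z.presheaf.stalk ξ') = 2 := (hdim' ξ' hξ').trans hn2'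
      have h1 : ¬ (IsRegularLocalRing (A'.Z.presheaf.stalk ξ') ∧ ringKrullDim (A'.Z.presheaf.stalk ξ') = 1) := by
        rintro ⟨-, h⟩; rw [hdim2] at h; exact absurd h (by decide)
      rw [hbE', germExitCount_eq_exitCount h1 (hπ.stalkEmb ξ') (hπ.stalkEmb_injective ξ')
        (fun z => exists_frac_stalkEmb hπ ξ' z), hJ'eq,
        map_rangeRestrict_stalkIdeal_transform_eq_ctrlTransform' hπξ' hξ hπ E]
    -- the value at the root
    have hroot : germExitCount (A.Z.presheaf.stalk ξ) (stalkIdeal E.J ξ) E.b = exitCount E.b R I := by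
      have h1 : ¬ (IsRegularLocalRing (A.Z.presheaf.stalk ξ) ∧ ringKrullDim (A.Z.presheaf.stalk ξ) = 1) := by
        rintro ⟨-, h⟩; rw [hn2'] at h; exact absurd h (by decide)
      refine germExitCount_eq_exitCount h1 ι hinj (fun z => ?_) _ _
      obtain ⟨a, c, hc, hac⟩ := IsFractionRing.div_surjective (A := A.Z.presheaf.stalk ξ) z
      exact ⟨a, c, (map_ne_zero_iff _ hinj).mpr (nonZeroDivisors.ne_zero hc), hac.symm⟩
    rw [hroot, Finset.sum_congr rfl hval]
    have key := sum_exitCount_lt_of_no_infinite_branch htame hno (t.image σ) hF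
    rwa [Finset.sum_image hσinj] at key

/-! ## The rung, modulo «no infinite marked branch» -/

/-- **RUNG (i-a)′ FROM THEOREM A (scheme-anchored form).** If for every ambient datum `A`, closed point `ξ` with
`dim 𝒪_{Z,ξ} = 2`, exponent `b` and ideal `I` making `⟨(𝒪_{Z,ξ} → K(Z)).range, I⟩` a tame isolated node there is no
infinite chain of marked steps out of it, then `PlaneIsolatedFinLocalExitBound p K` (with `β := germExitCount`); assembled
from the glue `planeIsolatedFinLocalExitBound_of_germLocal` and `germExitCount_centre_lt`. [folklore] -/
theorem planeIsolatedFinLocalExitBound_of_noInfiniteMarkedBranchAt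
    (hA : ∀ (A : AmbientDatum p K) (ξ : A.Z), IsClosed ({ξ} : Set A.Z) → ringKrullDim (A.Z.presheaf.stalk ξ) = 2 →
      ∀ (b : ℕ) (I : Ideal (haveI := ambient_isIntegral A;
        (algebraMap (A.Z.presheaf.stalk ξ) A.Z.functionField).range)),
        (haveI := ambient_isIntegral A
         IsTameNode b (⟨(algebraMap (A.Z.presheaf.stalk ξ) A.Z.functionField).range, I⟩ : MarkedNode A.Z.functionField)) →
        (haveI := ambient_isIntegral A
         ∀ q : (algebraMap (A.Z.presheaf.stalk ξ) A.Z.functionField).range, Prime q → ¬ I ≤ Ideal.span {q ^ b}) →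
        (haveI := ambient_isIntegral A
         ∀ c : ℕ → MarkedNode A.Z.functionField,
          c 0 = ⟨(algebraMap (A.Z.presheaf.stalk ξ) A.Z.functionField).range, I⟩ →
          (∀ i, MarkedStep b (c i) (c (i + 1))) → False)) :
    PlaneIsolatedFinLocalExitBound p K :=
  planeIsolatedFinLocalExitBound_of_germLocal (p := p) (K := K)
    (fun R _ I b => germExitCount R I b) (fun _ _ _ _ e I b => germExitCount_map_ringEquiv e I b)
    (fun A E ξ => germExitCount (A.Z.presheaf.stalk ξ) (stalkIdeal E.J ξ) E.b) (fun _ _ _ => rfl)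
    (fun A A' E E' ξ hξ π hRg hRg' hE hE' hξS hD hhom hπ hEE' t ht =>
      germExitCount_centre_lt hA A A' E E' ξ hξ π hRg hRg' hE hE' hξS hD hhom hπ hEE' t ht)

/-- **RUNG (i-a)′ FROM THEOREM A (pure-algebra form).** If for every field `L`, every exponent `b` and every TAME ISOLATED
marked node `n₀` (a two-dimensional regular local ring `S` of `L` with an ideal `I ⊆ 𝔪^b`, `I ⊄ 𝔪^{2b}`, `I ⊄ (q^b)` for
all prime elements `q`) there is no infinite chain of marked steps out of `n₀`, then `PlaneIsolatedFinLocalExitBound p K`.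
[folklore] -/
theorem planeIsolatedFinLocalExitBound_of_noInfiniteMarkedBranch
    (hA : ∀ (L : Type u) [Field L] (b : ℕ) (n₀ : MarkedNode L), IsTameNode b n₀ →
      (∀ q : n₀.1, Prime q → ¬ n₀.2 ≤ Ideal.span {q ^ b}) →
      ∀ c : ℕ → MarkedNode L, c 0 = n₀ → (∀ i, MarkedStep b (c i) (c (i + 1))) → False) :
    PlaneIsolatedFinLocalExitBound p K :=
  planeIsolatedFinLocalExitBound_of_noInfiniteMarkedBranchAt (p := p) (K := K)
    fun A ξ _ _ b I htame hiso c hc hstep => by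
      haveI := ambient_isIntegral A
      exact hA A.Z.functionField b _ htame hiso c hc hstep

/-- **The rung in all its forms from Theorem A**: résumé-free termination on surfaces with isolated singular locus and the
typed rungs for every notion instance, literal and ∇-centred. [folklore] -/
theorem planeIsolatedTerminates_of_noInfiniteMarkedBranch
    (hA : ∀ (L : Type u) [Field L] (b : ℕ) (n₀ : MarkedNode L), IsTameNode b n₀ →
      (∀ q : n₀.1, Prime q → ¬ n₀.2 ≤ Ideal.span {q ^ b}) →
      ∀ c : ℕ → MarkedNode L, c 0 = n₀ → (∀ i, MarkedStep b (c i) (c (i + 1))) → False) :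
    PlaneIsolatedPermissiblyTerminates p K ∧ PlaneIsolatedTerminates p K ∧ PlaneIsolatedTerminatesNabla p K :=
  have h := planeIsolatedFinLocalExitBound_of_noInfiniteMarkedBranch (p := p) (K := K) hA
  ⟨planeIsolatedPermissiblyTerminates_of_finLocalExitBound h, planeIsolatedTerminatesNabla_of_finLocalExitBound h⟩

end CampaignW46

end Summit.ResolutionOfSingularities.ResolutionOfSingularities.Theorems

end
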